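import Mathlib
import Literature.Probability.LatticeModels.SharpnessProofs
import HarnessLib

/-!
# Lattice-point counting on thin Euclidean shells of `ℤ³` (helpers for
`OctaveForgetting.SphereVarianceUpperBound`, item stmt-CriticalPhenomena-8106)

THEOREM-ONLY file (no definitions). The lattice sphere of the route `OctaveForgetting` is
`S_R = {y ∈ ℤ³ : R² ≤ |y|² < (R+1)²}`; every lemma below takes an arbitrary finite `S ⊆ ℤ³` all of
whose points satisfy this shell condition (hypothesis `hS`), so no new definition is introduced.

* `card_sphereCap_le` — the cap count: for every centre `a ∈ ℤ³` and every `k`,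
  `#{b ∈ S : ‖b - a‖_∞ ≤ k} ≤ 12 (2k+1)²` (for ALL `k`, not only `k ≤ R/4`). Proof: every shell
  point has a coordinate `l` and a sign `s` with `R ≤ 2 s x_l` (else `4|x|² < 3R²`); on such a
  half-axis piece project to the two other coordinates (at most `(2k+1)²` values) and observe that a
  fibre holds at most two points: integers `u < w` with `R ≤ 2u` and `u + 2 ≤ w` have
  `w² - u² ≥ 4u + 4 > 2R`, while all squares in a fibre lie in a window of length `2R + 1`.
* `sum_inv_supNorm_sphere_le` — Abel summation in Fubini form: with
  `1/max(1,n) ≤ ∑_{j=1}^{J} 1[n ≤ j]/(j(j+1)) + 1/(J+1)` and the cap count,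
  `∑_{b ∈ S} 1/max(1, ‖b-a‖_∞) ≤ 432 R` whenever all distances are `≤ 2R`.
* `sum_sum_sphere_le` — the double sum `∑_{a,b ∈ S} G(a,b) ≤ 46656 C₁ R³` for any kernel
  `G(a,b) ≤ C₁ / max(1, ‖b-a‖_∞)`, `S` inside the box `Λ_R`.

This is the free-field order `R²` points `×` `∑_{k ≤ R} k · k⁻¹` of the route text.
-/

namespace Summit.CriticalPhenomena.Ising3DConformalLimit.Theorems

open Literature.Probability.LatticeModels Finset

/-- Arithmetic core of the fibre bound: two integers `u ≤ w - 2` with `R ≤ 2u` cannot both have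
their squares in a common half-open window `[B, B + 2R + 1)`. [folklore] -/
theorem sphereCap_no_gap_two {R : ℕ} {B u w : ℤ} (hu : (R : ℤ) ≤ 2 * u) (huw : u + 2 ≤ w)
    (hBu : B ≤ u ^ 2) (hBw : w ^ 2 < B + 2 * R + 1) : False := by
  nlinarith [mul_nonneg (sub_nonneg.2 huw) (by linarith : (0 : ℤ) ≤ w + u)]

/-- Three pairwise distinct integers `uᵢ` with `R ≤ 2uᵢ` cannot all have their squares in a
common window `[B, B + 2R + 1)` (two of them differ by at least `2`). [folklore] -/
theorem sphereCap_three_distinct {R : ℕ} {B u₁ u₂ u₃ : ℤ} (h12 : u₁ ≠ u₂) (h13 : u₁ ≠ u₃)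
    (h23 : u₂ ≠ u₃) (h1 : (R : ℤ) ≤ 2 * u₁) (h2 : (R : ℤ) ≤ 2 * u₂) (h3 : (R : ℤ) ≤ 2 * u₃)
    (hB1 : B ≤ u₁ ^ 2) (hB2 : B ≤ u₂ ^ 2) (hB3 : B ≤ u₃ ^ 2)
    (hB1' : u₁ ^ 2 < B + 2 * R + 1) (hB2' : u₂ ^ 2 < B + 2 * R + 1)
    (hB3' : u₃ ^ 2 < B + 2 * R + 1) : False := by
  rcases (show u₁ + 2 ≤ u₂ ∨ u₂ + 2 ≤ u₁ ∨ u₁ + 2 ≤ u₃ ∨ u₃ + 2 ≤ u₁ ∨ u₂ + 2 ≤ u₃ ∨ u₃ + 2 ≤ u₂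
    by omega) with h | h | h | h | h | h
  · exact sphereCap_no_gap_two h1 h hB1 hB2'
  · exact sphereCap_no_gap_two h2 h hB2 hB1'
  · exact sphereCap_no_gap_two h1 h hB1 hB3'
  · exact sphereCap_no_gap_two h3 h hB3 hB1'
  · exact sphereCap_no_gap_two h2 h hB2 hB3'
  · exact sphereCap_no_gap_two h3 h hB3 hB2'

/-- **Half-axis cap count.** On the piece of the shell cap `{b ∈ S : ‖b - a‖_∞ ≤ k}` where the
coordinate `l` satisfies `R ≤ 2 s b_l` (`s = ±1`), projecting to the two remaining coordinates
`(i, j)` is at most two-to-one onto a `(2k+1) × (2k+1)` square, so the piece has at most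
`2 (2k+1)²` points. The coordinate bookkeeping (`∑ₘ xₘ² = x_l² + x_i² + x_j²` and extensionality
in the three coordinates) is passed as hypotheses and discharged for the three concrete axes in
`card_sphereCap_le`. [folklore] -/
theorem card_sphereCap_halfAxis_le (R k : ℕ) (S : Finset (Site 3))
    (hS : ∀ y ∈ S, (R : ℤ) ^ 2 ≤ ∑ i, y i ^ 2 ∧ ∑ i, y i ^ 2 < ((R : ℤ) + 1) ^ 2)
    (a : Site 3) (l i j : Fin 3)
    (hsum : ∀ x : Site 3, ∑ m, x m ^ 2 = x l ^ 2 + x i ^ 2 + x j ^ 2)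
    (hext : ∀ x y : Site 3, x l = y l → x i = y i → x j = y j → x = y)
    (s : ℤ) (hs : s = 1 ∨ s = -1) :
    #((S.filter fun b => Site.supNorm (b - a) ≤ k).filter fun x => (R : ℤ) ≤ 2 * (s * x l))
      ≤ 2 * (2 * k + 1) ^ 2 := by
  classical
  set F := (S.filter fun b => Site.supNorm (b - a) ≤ k).filter fun x => (R : ℤ) ≤ 2 * (s * x l)
    with hF
  set t : Finset (ℤ × ℤ) := Icc (a i - k) (a i + k) ×ˢ Icc (a j - k) (a j + k) with ht
  have hmem : ∀ x ∈ F, x ∈ S ∧ Site.supNorm (x - a) ≤ k ∧ (R : ℤ) ≤ 2 * (s * x l) := by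
    intro x hx
    simp only [hF, mem_filter] at hx
    exact ⟨hx.1.1, hx.1.2, hx.2⟩
  have hmaps : ∀ x ∈ F, (x i, x j) ∈ t := by
    intro x hx
    obtain ⟨-, hk, -⟩ := hmem x hx
    have hi := (Site.natAbs_le_supNorm (x - a) i).trans hk
    have hj := (Site.natAbs_le_supNorm (x - a) j).trans hk
    simp only [Pi.sub_apply] at hi hj
    simp only [ht, mem_product, mem_Icc]
    omega
  have htcard : #t = (2 * k + 1) ^ 2 := by
    have h1 : (a i + k + 1 - (a i - k)).toNat = 2 * k + 1 := by omega
    have h2 : (a j + k + 1 - (a j - k)).toNat = 2 * k + 1 := by omega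
    rw [ht, card_product, Int.card_Icc, Int.card_Icc, h1, h2, sq]
  have hs0 : s ≠ 0 := by rcases hs with rfl | rfl <;> norm_num
  have hsq : ∀ z : ℤ, (s * z) ^ 2 = z ^ 2 := by
    intro z; rcases hs with rfl | rfl <;> ring
  have hfib : ∀ p ∈ t, #(F.filter fun x => (x i, x j) = p) ≤ 2 := by
    intro p _
    by_contra hlt
    push Not at hlt
    obtain ⟨x, hx, y, hy, z, hz, hxy, hxz, hyz⟩ := two_lt_card.1 hlt
    rw [mem_filter] at hx hy hz
    obtain ⟨hxF, hxp⟩ := hx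
    obtain ⟨hyF, hyp⟩ := hy
    obtain ⟨hzF, hzp⟩ := hz
    have hxi : x i = p.1 := by rw [← hxp]
    have hxj : x j = p.2 := by rw [← hxp]
    have hyi : y i = p.1 := by rw [← hyp]
    have hyj : y j = p.2 := by rw [← hyp]
    have hzi : z i = p.1 := by rw [← hzp]
    have hzj : z j = p.2 := by rw [← hzp]
    obtain ⟨hxS, -, hxl⟩ := hmem x hxF
    obtain ⟨hyS, -, hyl⟩ := hmem y hyF
    obtain ⟨hzS, -, hzl⟩ := hmem z hzF
    have hl_xy : s * x l ≠ s * y l := fun h =>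
      hxy (hext x y (mul_left_cancel₀ hs0 h) (by rw [hxi, hyi]) (by rw [hxj, hyj]))
    have hl_xz : s * x l ≠ s * z l := fun h =>
      hxz (hext x z (mul_left_cancel₀ hs0 h) (by rw [hxi, hzi]) (by rw [hxj, hzj]))
    have hl_yz : s * y l ≠ s * z l := fun h =>
      hyz (hext y z (mul_left_cancel₀ hs0 h) (by rw [hyi, hzi]) (by rw [hyj, hzj]))
    have hx2 := hS x hxS
    have hy2 := hS y hyS
    have hz2 := hS z hzS
    rw [hsum x, hxi, hxj] at hx2
    rw [hsum y, hyi, hyj] at hy2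
    rw [hsum z, hzi, hzj] at hz2
    refine sphereCap_three_distinct (R := R) (B := (R : ℤ) ^ 2 - p.1 ^ 2 - p.2 ^ 2) hl_xy hl_xz
      hl_yz hxl hyl hzl ?_ ?_ ?_ ?_ ?_ ?_
    · rw [hsq]; linarith [hx2.1]
    · rw [hsq]; linarith [hy2.1]
    · rw [hsq]; linarith [hz2.1]
    · rw [hsq]; linarith [hx2.2]
    · rw [hsq]; linarith [hy2.2]
    · rw [hsq]; linarith [hz2.2]
  calc #F ≤ 2 * #t := card_le_mul_card_image_of_maps_to hmaps 2 hfib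
    _ = 2 * (2 * k + 1) ^ 2 := by rw [htcard]

/-- **Cap count on a thin Euclidean shell of `ℤ³`.** If every point of `S` satisfies
`R² ≤ |y|² < (R+1)²`, then for every centre `a ∈ ℤ³` and every `k`,
`#{b ∈ S : ‖b - a‖_∞ ≤ k} ≤ 12 (2k+1)²`: the cap is covered by the six half-axis pieces
`R ≤ 2 s b_l` (`l ∈ {0,1,2}`, `s = ±1`; if all six failed then `4|b|² < 3R² ≤ 3|b|²`), each of
size `≤ 2(2k+1)²` by `card_sphereCap_halfAxis_le`. [folklore] -/
theorem card_sphereCap_le (R k : ℕ) (S : Finset (Site 3))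
    (hS : ∀ y ∈ S, (R : ℤ) ^ 2 ≤ ∑ i, y i ^ 2 ∧ ∑ i, y i ^ 2 < ((R : ℤ) + 1) ^ 2)
    (a : Site 3) :
    #(S.filter fun b => Site.supNorm (b - a) ≤ k) ≤ 12 * (2 * k + 1) ^ 2 := by
  classical
  set F := S.filter fun b => Site.supNorm (b - a) ≤ k with hF
  have hsum0 : ∀ x : Site 3, ∑ m, x m ^ 2 = x 0 ^ 2 + x 1 ^ 2 + x 2 ^ 2 := fun x => by
    rw [Fin.sum_univ_three]
  have hsum1 : ∀ x : Site 3, ∑ m, x m ^ 2 = x 1 ^ 2 + x 0 ^ 2 + x 2 ^ 2 := fun x => by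
    rw [Fin.sum_univ_three]; ring
  have hsum2 : ∀ x : Site 3, ∑ m, x m ^ 2 = x 2 ^ 2 + x 0 ^ 2 + x 1 ^ 2 := fun x => by
    rw [Fin.sum_univ_three]; ring
  have hext0 : ∀ x y : Site 3, x 0 = y 0 → x 1 = y 1 → x 2 = y 2 → x = y := by
    intro x y h0 h1 h2; funext m; fin_cases m <;> assumption
  have hext1 : ∀ x y : Site 3, x 1 = y 1 → x 0 = y 0 → x 2 = y 2 → x = y :=
    fun x y h1 h0 h2 => hext0 x y h0 h1 h2
  have hext2 : ∀ x y : Site 3, x 2 = y 2 → x 0 = y 0 → x 1 = y 1 → x = y :=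
    fun x y h2 h0 h1 => hext0 x y h0 h1 h2
  set A0p := F.filter fun x => (R : ℤ) ≤ 2 * (1 * x 0) with hA0p
  set A0m := F.filter fun x => (R : ℤ) ≤ 2 * (-1 * x 0) with hA0m
  set A1p := F.filter fun x => (R : ℤ) ≤ 2 * (1 * x 1) with hA1p
  set A1m := F.filter fun x => (R : ℤ) ≤ 2 * (-1 * x 1) with hA1m
  set A2p := F.filter fun x => (R : ℤ) ≤ 2 * (1 * x 2) with hA2p
  set A2m := F.filter fun x => (R : ℤ) ≤ 2 * (-1 * x 2) with hA2m
  have h0p : #A0p ≤ 2 * (2 * k + 1) ^ 2 :=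
    card_sphereCap_halfAxis_le R k S hS a 0 1 2 hsum0 hext0 1 (Or.inl rfl)
  have h0m : #A0m ≤ 2 * (2 * k + 1) ^ 2 :=
    card_sphereCap_halfAxis_le R k S hS a 0 1 2 hsum0 hext0 (-1) (Or.inr rfl)
  have h1p : #A1p ≤ 2 * (2 * k + 1) ^ 2 :=
    card_sphereCap_halfAxis_le R k S hS a 1 0 2 hsum1 hext1 1 (Or.inl rfl)
  have h1m : #A1m ≤ 2 * (2 * k + 1) ^ 2 :=
    card_sphereCap_halfAxis_le R k S hS a 1 0 2 hsum1 hext1 (-1) (Or.inr rfl)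
  have h2p : #A2p ≤ 2 * (2 * k + 1) ^ 2 :=
    card_sphereCap_halfAxis_le R k S hS a 2 0 1 hsum2 hext2 1 (Or.inl rfl)
  have h2m : #A2m ≤ 2 * (2 * k + 1) ^ 2 :=
    card_sphereCap_halfAxis_le R k S hS a 2 0 1 hsum2 hext2 (-1) (Or.inr rfl)
  have hcov : F ⊆ (A0p ∪ A0m) ∪ ((A1p ∪ A1m) ∪ (A2p ∪ A2m)) := by
    intro x hx
    have hxS : x ∈ S := (mem_filter.1 hx).1
    obtain ⟨hlo, -⟩ := hS x hxS
    rw [Fin.sum_univ_three] at hlo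
    have key : (R : ℤ) ≤ 2 * (1 * x 0) ∨ (R : ℤ) ≤ 2 * (-1 * x 0) ∨ (R : ℤ) ≤ 2 * (1 * x 1) ∨
        (R : ℤ) ≤ 2 * (-1 * x 1) ∨ (R : ℤ) ≤ 2 * (1 * x 2) ∨ (R : ℤ) ≤ 2 * (-1 * x 2) := by
      by_contra h
      push Not at h
      obtain ⟨h0, h0', h1, h1', h2, h2'⟩ := h
      nlinarith [mul_pos (sub_pos.2 h0) (sub_pos.2 h0'), mul_pos (sub_pos.2 h1) (sub_pos.2 h1'),
        mul_pos (sub_pos.2 h2) (sub_pos.2 h2'), sq_nonneg (R : ℤ)]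
    simp only [mem_union, hA0p, hA0m, hA1p, hA1m, hA2p, hA2m, mem_filter]
    rcases key with h | h | h | h | h | h
    · exact Or.inl (Or.inl ⟨hx, h⟩)
    · exact Or.inl (Or.inr ⟨hx, h⟩)
    · exact Or.inr (Or.inl (Or.inl ⟨hx, h⟩))
    · exact Or.inr (Or.inl (Or.inr ⟨hx, h⟩))
    · exact Or.inr (Or.inr (Or.inl ⟨hx, h⟩))
    · exact Or.inr (Or.inr (Or.inr ⟨hx, h⟩))
  have e0 := card_le_card hcov
  have e1 := card_union_le (A0p ∪ A0m) ((A1p ∪ A1m) ∪ (A2p ∪ A2m))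
  have e2 := card_union_le A0p A0m
  have e3 := card_union_le (A1p ∪ A1m) (A2p ∪ A2m)
  have e4 := card_union_le A1p A1m
  have e5 := card_union_le A2p A2m
  set N := (2 * k + 1) ^ 2 with hN
  omega

/-- The whole shell inside the box `Λ_R` has at most `12 (2R+1)²` points (the cap count at the
origin with `k = R`). [folklore] -/
theorem card_sphere_le (R : ℕ) (S : Finset (Site 3))
    (hS : ∀ y ∈ S, (R : ℤ) ^ 2 ≤ ∑ i, y i ^ 2 ∧ ∑ i, y i ^ 2 < ((R : ℤ) + 1) ^ 2)
    (hbox : ∀ y ∈ S, Site.supNorm y ≤ R) : #S ≤ 12 * (2 * R + 1) ^ 2 := by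
  classical
  have h := card_sphereCap_le R R S hS 0
  rw [filter_true_of_mem] at h
  · exact h
  · intro y hy
    rw [sub_zero]
    exact hbox y hy

/-- Telescoping (Abel summation in Fubini form): for `0 ≤ n ≤ J`,
`1 / max(1, n) ≤ ∑_{j=1}^{J} 1[n ≤ j] / (j(j+1)) + 1/(J+1)` (in fact an equality, since
`1/(j(j+1)) = 1/j - 1/(j+1)`). [folklore] -/
theorem one_div_max_le_sum_Icc (n J : ℕ) (hn : n ≤ J) :
    (1 : ℝ) / max 1 (n : ℝ) ≤
      (∑ j ∈ Icc 1 J, if n ≤ j then (1 : ℝ) / ((j : ℝ) * ((j : ℝ) + 1)) else 0) +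
        1 / ((J : ℝ) + 1) := by
  induction J with
  | zero =>
    obtain rfl : n = 0 := Nat.le_zero.1 hn
    simp
  | succ J ih =>
    rw [sum_Icc_succ_top (by omega), if_pos hn]
    simp only [Nat.cast_add_one]
    have hJ0 : (0 : ℝ) ≤ (J : ℝ) := Nat.cast_nonneg J
    have hne1 : (J : ℝ) + 1 ≠ 0 := by positivity
    have hne2 : (J : ℝ) + 1 + 1 ≠ 0 := by positivity
    have hsplit : (1 : ℝ) / ((J : ℝ) + 1) =
        1 / (((J : ℝ) + 1) * ((J : ℝ) + 1 + 1)) + 1 / ((J : ℝ) + 1 + 1) := by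
      field_simp
      ring
    rcases Nat.lt_or_ge n (J + 1) with h | h
    · have ih' := ih (by omega)
      linarith
    · obtain rfl : n = J + 1 := le_antisymm hn h
      simp only [Nat.cast_add_one]
      have hnonneg : 0 ≤ ∑ j ∈ Icc 1 J,
          (if J + 1 ≤ j then (1 : ℝ) / ((j : ℝ) * ((j : ℝ) + 1)) else 0) :=
        sum_nonneg fun j _ => by split_ifs <;> positivity
      have hmax : max 1 ((J : ℝ) + 1) = (J : ℝ) + 1 := max_eq_right (by linarith)
      rw [hmax]
      linarith

/-- **The `1/r` sum over a thin shell of `ℤ³` is `O(R)`.** If every point of `S` satisfies the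
shell condition and lies within sup-distance `2R` of `a` (`R ≥ 1`), then
`∑_{b ∈ S} 1 / max(1, ‖b - a‖_∞) ≤ 432 R`: Abel summation (`one_div_max_le_sum_Icc`, then
Fubini) against the cap counts `#{‖b-a‖_∞ ≤ j} ≤ 12(2j+1)² ≤ 108 j(j+1)`. [folklore] -/
theorem sum_inv_supNorm_sphere_le (R : ℕ) (hR : 1 ≤ R) (S : Finset (Site 3))
    (hS : ∀ y ∈ S, (R : ℤ) ^ 2 ≤ ∑ i, y i ^ 2 ∧ ∑ i, y i ^ 2 < ((R : ℤ) + 1) ^ 2)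
    (a : Site 3) (ha : ∀ b ∈ S, Site.supNorm (b - a) ≤ 2 * R) :
    ∑ b ∈ S, (1 : ℝ) / max 1 (Site.supNorm (b - a) : ℝ) ≤ 432 * R := by
  classical
  set J := 2 * R with hJ
  have hJ1 : 1 ≤ J := by omega
  have step1 : ∑ b ∈ S, (1 : ℝ) / max 1 (Site.supNorm (b - a) : ℝ) ≤
      ∑ b ∈ S, ((∑ j ∈ Icc 1 J, if Site.supNorm (b - a) ≤ j then
          (1 : ℝ) / ((j : ℝ) * ((j : ℝ) + 1)) else 0) + 1 / ((J : ℝ) + 1)) :=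
    sum_le_sum fun b hb => one_div_max_le_sum_Icc _ J (ha b hb)
  rw [sum_add_distrib, sum_comm, sum_const, nsmul_eq_mul] at step1
  have step2 : ∀ j ∈ Icc 1 J, (∑ b ∈ S, if Site.supNorm (b - a) ≤ j then
      (1 : ℝ) / ((j : ℝ) * ((j : ℝ) + 1)) else 0) ≤ 108 := by
    intro j hj
    rw [← sum_filter, sum_const, nsmul_eq_mul]
    have hj1 : (1 : ℝ) ≤ j := by exact_mod_cast (mem_Icc.1 hj).1
    have hc : (#(S.filter fun b => Site.supNorm (b - a) ≤ j) : ℝ) ≤ 12 * (2 * (j : ℝ) + 1) ^ 2 := by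
      exact_mod_cast card_sphereCap_le R j S hS a
    have hpos : (0 : ℝ) < (j : ℝ) * ((j : ℝ) + 1) := by positivity
    calc (#(S.filter fun b => Site.supNorm (b - a) ≤ j) : ℝ) * (1 / ((j : ℝ) * ((j : ℝ) + 1)))
        = #(S.filter fun b => Site.supNorm (b - a) ≤ j) / ((j : ℝ) * ((j : ℝ) + 1)) := by ring
      _ ≤ 12 * (2 * (j : ℝ) + 1) ^ 2 / ((j : ℝ) * ((j : ℝ) + 1)) := by gcongr
      _ ≤ 108 := by rw [div_le_iff₀ hpos]; nlinarith
  have step3 : ∑ j ∈ Icc 1 J, (∑ b ∈ S, if Site.supNorm (b - a) ≤ j then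
      (1 : ℝ) / ((j : ℝ) * ((j : ℝ) + 1)) else 0) ≤ 108 * J := by
    calc _ ≤ ∑ j ∈ Icc 1 J, (108 : ℝ) := sum_le_sum step2
      _ = 108 * J := by rw [sum_const, Nat.card_Icc, Nat.add_sub_cancel, nsmul_eq_mul]; ring
  have hcardS : (#S : ℝ) ≤ 12 * (2 * (J : ℝ) + 1) ^ 2 := by
    have h := card_sphereCap_le R J S hS a
    rw [filter_true_of_mem ha] at h
    exact_mod_cast h
  have hJr : (1 : ℝ) ≤ J := by exact_mod_cast hJ1
  have step4 : (#S : ℝ) * (1 / ((J : ℝ) + 1)) ≤ 108 * J := by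
    have hpos : (0 : ℝ) < (J : ℝ) + 1 := by positivity
    calc (#S : ℝ) * (1 / ((J : ℝ) + 1)) = #S / ((J : ℝ) + 1) := by ring
      _ ≤ 12 * (2 * (J : ℝ) + 1) ^ 2 / ((J : ℝ) + 1) := by gcongr
      _ ≤ 108 * J := by rw [div_le_iff₀ hpos]; nlinarith
  have hJR : (J : ℝ) = 2 * R := by simp only [hJ, Nat.cast_mul, Nat.cast_ofNat]
  calc ∑ b ∈ S, (1 : ℝ) / max 1 (Site.supNorm (b - a) : ℝ) ≤ _ := step1
    _ ≤ 108 * J + 108 * J := add_le_add step3 step4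
    _ = 432 * R := by rw [hJR]; ring

/-- **The double sum over a thin shell is `O(R³)`.** If every point of `S` satisfies the shell
condition `R² ≤ |y|² < (R+1)²` and lies in the box `Λ_R` (`R ≥ 1`), and a kernel satisfies
`G(a,b) ≤ C₁ / max(1, ‖b-a‖_∞)` with `C₁ ≥ 0`, then `∑_{a ∈ S} ∑_{b ∈ S} G(a,b) ≤ 46656 C₁ R³`
(`#S ≤ 12(2R+1)² ≤ 108 R²` centres, each row `≤ 432 C₁ R`). [folklore] -/
theorem sum_sum_sphere_le (R : ℕ) (hR : 1 ≤ R) (S : Finset (Site 3))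
    (hS : ∀ y ∈ S, (R : ℤ) ^ 2 ≤ ∑ i, y i ^ 2 ∧ ∑ i, y i ^ 2 < ((R : ℤ) + 1) ^ 2)
    (hbox : ∀ y ∈ S, Site.supNorm y ≤ R) (C₁ : ℝ) (hC₁ : 0 ≤ C₁) (G : Site 3 → Site 3 → ℝ)
    (hG : ∀ a b : Site 3, G a b ≤ C₁ / max 1 (Site.supNorm (b - a) : ℝ)) :
    ∑ a ∈ S, ∑ b ∈ S, G a b ≤ 46656 * C₁ * (R : ℝ) ^ 3 := by
  classical
  have hdist : ∀ a ∈ S, ∀ b ∈ S, Site.supNorm (b - a) ≤ 2 * R := by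
    intro a ha b hb
    have h : (Site.supNorm (b - a) : ℝ) ≤ Site.supNorm b + Site.supNorm a := by
      rw [← Site.norm_eq_supNorm, ← Site.norm_eq_supNorm, ← Site.norm_eq_supNorm]
      exact norm_sub_le b a
    have h' : Site.supNorm (b - a) ≤ Site.supNorm b + Site.supNorm a := by exact_mod_cast h
    have := hbox a ha
    have := hbox b hb
    omega
  have hrow : ∀ a ∈ S, ∑ b ∈ S, G a b ≤ C₁ * (432 * R) := by
    intro a ha
    calc ∑ b ∈ S, G a b ≤ ∑ b ∈ S, C₁ * (1 / max 1 (Site.supNorm (b - a) : ℝ)) :=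
          sum_le_sum fun b _ => by rw [← div_eq_mul_one_div]; exact hG a b
      _ = C₁ * ∑ b ∈ S, 1 / max 1 (Site.supNorm (b - a) : ℝ) := by rw [mul_sum]
      _ ≤ C₁ * (432 * R) :=
          mul_le_mul_of_nonneg_left (sum_inv_supNorm_sphere_le R hR S hS a (hdist a ha)) hC₁
  have hcardS : (#S : ℝ) ≤ 12 * (2 * (R : ℝ) + 1) ^ 2 := by
    exact_mod_cast card_sphere_le R S hS hbox
  have hR1 : (1 : ℝ) ≤ R := by exact_mod_cast hR
  calc ∑ a ∈ S, ∑ b ∈ S, G a b ≤ ∑ a ∈ S, C₁ * (432 * R) := sum_le_sum hrow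
    _ = #S * (C₁ * (432 * R)) := by rw [sum_const, nsmul_eq_mul]
    _ ≤ 12 * (2 * (R : ℝ) + 1) ^ 2 * (C₁ * (432 * R)) :=
        mul_le_mul_of_nonneg_right hcardS (by positivity)
    _ ≤ 46656 * C₁ * (R : ℝ) ^ 3 := by
        have h := mul_nonneg (mul_nonneg hC₁ (Nat.cast_nonneg R))
          (mul_nonneg (sub_nonneg.2 hR1) (by positivity : (0 : ℝ) ≤ 5 * (R : ℝ) + 1))
        nlinarith [h]

end Summit.CriticalPhenomena.Ising3DConformalLimit.Theorems
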